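import Summits.SmoothPoincare4.SmoothPoincare4.Theorems.EntropyRungChangGurskyYangStubPathMapStrictFDeriv
import Summits.SmoothPoincare4.SmoothPoincare4.Theorems.EntropyRungChangGurskyYangStubLinearisedInvertible
import Summits.SmoothPoincare4.SmoothPoincare4.Theorems.EntropyRungChangGurskyYangStubRegularityOfInduction
import Summits.SmoothPoincare4.SmoothPoincare4.Theorems.EntropyRungChangGurskyYangHelperRegularityInductionHolds
import Summits.SmoothPoincare4.SmoothPoincare4.Theorems.EntropyRungChangGurskyYangStubBackgroundScalarTendsto
import Summits.SmoothPoincare4.SmoothPoincare4.Theorems.EntropyRungChangGurskyYangOfGvPathFacts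
import Summits.SmoothPoincare4.SmoothPoincare4.Theorems.EntropyRungChangGurskyYangFlowLeafClosed
import Literature.Geometry.Riemannian.GurskyViaclovskyOpenness
import Literature.Geometry.Riemannian.GurskyViaclovskyOpennessProofs
import Literature.Geometry.Riemannian.GurskyViaclovskyC1EstimateProofs
import Literature.Geometry.Riemannian.GurskyViaclovskyC2EstimateProofs
import Literature.Geometry.Riemannian.GurskyViaclovskyClosednessEvansKrylov
import HarnessLib

/-!
# The crux `EntropyRung.ChangGurskyYang` (Chang–Gursky–Yang 2003, Theorem A′) — PROVED
# (line `margerin-cone-hamilton-rails`, stmt-SmoothPoincare4-10834)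

A closed simply connected smooth `4`-manifold carrying a Riemannian metric with positive scalar
curvature and `∫|W|² < 32π²` is diffeomorphic to `S⁴`. The composition
`GvContinuityPath.ChangGurskyYang_of_gvPathFacts` (Chern–Gauss–Bonnet ⇒ (1.2); CGY Thm. 1.4 in the
connected `R > 0` shape by the Gursky–Viaclovsky weighted `σ₂` continuity path; "rearranging terms"
`WP < 1/6`; Margerin's sharp weak pinching theorem via Hamilton's flow and the convergence criterion
§5.2; `π₁ = 1` discards `ℝP⁴`) is applied to five analytic facts, ALL THEOREMS of the tree: the GV
a-priori `C¹`/`C²` estimates (`gurskyViaclovsky_gradientEstimate_weighted_four_holds`,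
`gurskyViaclovsky_hessianEstimate_weighted_four_holds`), closedness
(`gurskyViaclovsky_pathClosed_weighted_four_holds`, Evans–Krylov), Hamilton's convergence criterion
(`hamilton_convergenceCriterion_four_holds`), and OPENNESS, proved in this file:

* `stub_regularity` — admissible `C^{2,α}_𝔄` solutions of the weighted path equation with `t ≤ 1`
  are `C^∞`: the manifold assembly `stub_regularity_of_induction` fed with the chart-level
  regularity induction `helper_regularityInduction` (Gilbarg–Trudinger Lemma 17.16: difference
  quotients, interior Schauder, differentiation of the equation);
* `stub_gvOpen` = `gurskyViaclovsky_pathOpen_weighted_four_holds` — Gursky–Viaclovsky Prop. 2 + §5: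
  the implicit function theorem in `X = C^{2,α}_𝔄(M)`, `Y = C^{0,α}_𝔄(M)` (`HolderManifoldFunction`,
  Hölder chart data `𝔄`, `α = 1/2`) over the dictionary of `GurskyViaclovskyOpennessProofs.lean`,
  with the zero-finding map of `stub_pathMapStrictFDeriv`, the invertible linearisation
  `stub_linearisedInvertible` (GV Prop. 2), persistence of admissibility
  `stub_backgroundScalarTendsto`, and `stub_regularity`;
* `ChangGurskyYang_proof` — the crux, by name; `ChangGurskyYang_weylBudget_proof` — the same
  proposition under the item's other route decl.

## References

* S.-Y. A. Chang, M. J. Gursky, P. C. Yang, *A conformally invariant sphere theorem in four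
  dimensions*, Publ. Math. IHÉS 98 (2003) 105–143, Thm. A′ and §2. [ChangGurskyYang2003]
* M. J. Gursky, J. A. Viaclovsky, *A fully nonlinear equation on four-manifolds with positive
  scalar curvature*, J. Differential Geom. 63 (2003) 131–154, Prop. 2 and §5. [GurskyViaclovsky2003]
* D. Gilbarg, N. S. Trudinger, *Elliptic Partial Differential Equations of Second Order* (2001),
  Thm. 17.6, Lemma 17.16. [GilbargTrudinger2001]
* C. Margerin, Comm. Anal. Geom. 6 (1998) 21–65, Thm. 1. [Margerin1998]
* R. S. Hamilton, J. Differential Geom. 24 (1986) 153–179, §5. [Hamilton1986]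
-/

noncomputable section

set_option linter.dupNamespace false

open Set Function Filter
open scoped Manifold ContDiff Topology NNReal

namespace Summit.SmoothPoincare4.SmoothPoincare4.Theorems.MargerinRails

open Literature.Analysis.FunctionSpaces Literature.Geometry.Riemannian
open Literature.Geometry.Riemannian.GurskyViaclovskyPath
open Literature.Geometry.Lorentzian Literature.Geometry.Lorentzian.PseudoRiemannianMetric
open Summit.SmoothPoincare4.SmoothPoincare4.Theorems.GvContinuityPath

/-- **STUB O3 — ELLIPTIC REGULARITY: admissible `C^{2,α}_𝔄` solutions of the weighted path equation
with `t ≤ 1` are `C^∞`** (Gursky–Viaclovsky 2003, §5 "classical elliptic regularity theory" =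
Gilbarg–Trudinger Lemma 17.16, regularity half): the manifold assembly
`stub_regularity_of_induction` applied to the chart-level induction `helper_regularityInduction`.
[cite: GurskyViaclovsky2003, §5] [cite: GilbargTrudinger2001, Lemma 17.16] -/
theorem stub_regularity :
    ∀ (M : Type) [TopologicalSpace M] [T2Space M] [ChartedSpace (EuclideanSpace ℝ (Fin 4)) M]
      [IsManifold (𝓡 4) ∞ M] [CompactSpace M] {ι : Type} [Fintype ι]
      (𝔄 : HolderChartData ι (EuclideanSpace ℝ (Fin 4)) M)
      (g : PseudoRiemannianMetric (𝓡 4) ∞ (EuclideanSpace ℝ (Fin 4)) (TangentSpace (𝓡 4) : M → Type _))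
      [g.HasLeviCivita], g.IsRiemannian →
      ∀ (q : M → ℝ), ContMDiff (𝓡 4) 𝓘(ℝ) ∞ q → (∀ x, 0 < q x) → ∀ {α : ℝ≥0}, 0 < α → α < 1 →
      ∀ (t : ℝ), t ≤ 1 → ∀ (w : HolderManifoldFunction 𝔄 ℝ 2 α),
      (∀ x, 0 < backgroundScalar g w x) →
      (∀ x, backgroundPathOperator g t w x = q x * Real.exp (-4 * w x)) →
      ContMDiff (𝓡 4) 𝓘(ℝ) ∞ (w : M → ℝ) :=
  stub_regularity_of_induction helper_regularityInduction

/-- **GURSKY–VIACLOVSKY OPENNESS (Prop. 2 + §5) — the named fact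
`gurskyViaclovsky_pathOpen_weighted_four`, PROVED.** Hölder chart data `𝔄` on the compact `M`
(`HolderChartData.exists_of_compactSpace`), `α = 1/2`, the background solution `w₀` at `t₀`
(`solvable_iff_exists_background`) as a member `W₀ ∈ X` (`ofContMDiff`), the zero-finding map `Φ` of
`stub_pathMapStrictFDeriv` with `Φ(t₀, W₀) = 0`, invertibility of `∂_wΦ(t₀, W₀)`
(`stub_linearisedInvertible`), the implicit function theorem (`exists_solution_nhds_of_hasStrictFDerivAt`)
giving `t ↦ ψ_t` with `Φ(t, ψ_t) = 0` and `ψ_t → W₀`, persistence of `backgroundScalar > 0`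
(`stub_backgroundScalarTendsto`, `eventually_forall_pos_of_tendstoUniformly`), smoothness of `ψ_t` for
`t ≤ 1` (`stub_regularity`), and `solvable_of_background`; `exists_Ioo_of_eventually_nhds` produces the
interval. [cite: GurskyViaclovsky2003, Prop. 2 and §5] [cite: GilbargTrudinger2001, Thm. 17.6] -/
theorem stub_gvOpen : gurskyViaclovsky_pathOpen_weighted_four := by
  intro M _ _ _ _ _ _ _ g _ hg q hq hqpos t₀ ht₀ hsolv
  classical
  -- Hölder chart data on the compact manifold, exponent `α = 1/2`
  obtain ⟨s, ⟨𝔄⟩⟩ := HolderChartData.exists_of_compactSpace (EuclideanSpace ℝ (Fin 4)) M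
  set α : ℝ≥0 := 1 / 2 with hαdef
  have hα0 : 0 < α := by rw [hαdef]; positivity
  have hα1 : α < 1 := by rw [hαdef]; exact NNReal.half_lt_self one_ne_zero
  -- the smooth admissible background solution at `t₀`
  obtain ⟨w₀, hw₀, hpos₀, heq₀⟩ := (solvable_iff_exists_background g hg t₀ q).1 hsolv
  set W₀ : HolderManifoldFunction 𝔄 ℝ 2 α := HolderManifoldFunction.ofContMDiff w₀ hw₀ hα1.le
    with hW₀def
  have hW₀ : ((W₀ : HolderManifoldFunction 𝔄 ℝ 2 α) : M → ℝ) = w₀ :=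
    HolderManifoldFunction.coe_ofContMDiff w₀ hw₀ hα1.le
  -- the zero-finding map and its strict derivative at `(t₀, W₀)`
  obtain ⟨Φ, hΦeq, hΦd⟩ := stub_pathMapStrictFDeriv M 𝔄 g hg q hq hα1.le
  obtain ⟨Φ', hΦ', hΦ'eq⟩ := hΦd t₀ W₀
  -- its partial derivative in `w` is invertible
  have hinv : (Φ' ∘L ContinuousLinearMap.inr ℝ ℝ (HolderManifoldFunction 𝔄 ℝ 2 α)).IsInvertible := by
    refine stub_linearisedInvertible M 𝔄 g hg q hq hqpos hα0 hα1 t₀ ht₀ w₀ hw₀ hpos₀ heq₀ _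
      fun φ x => ?_
    rw [ContinuousLinearMap.comp_apply, ContinuousLinearMap.inr_apply, hΦ'eq φ x, hW₀]
  -- `Φ(t₀, W₀) = 0`
  have h0 : Φ (t₀, W₀) = 0 := by
    refine HolderManifoldFunction.ext fun x => ?_
    rw [hΦeq, hW₀, heq₀ x, sub_self, HolderManifoldFunction.coe_zero, Pi.zero_apply]
  -- the implicit function theorem
  obtain ⟨ψ, hψ, hzero⟩ := exists_solution_nhds_of_hasStrictFDerivAt hΦ' hinv h0
  have heq : ∀ᶠ t in 𝓝 t₀, ∀ x,
      backgroundPathOperator g t (ψ t) x = q x * Real.exp (-4 * ψ t x) := by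
    filter_upwards [hzero] with t ht x
    have h := congrArg (fun F : HolderManifoldFunction 𝔄 ℝ 0 α => F x) ht
    simp only [hΦeq, HolderManifoldFunction.coe_zero, Pi.zero_apply] at h
    linarith
  -- admissibility persists
  have hunif : TendstoUniformly (fun t x => backgroundScalar g (ψ t) x) (backgroundScalar g w₀)
      (𝓝 t₀) := by
    have h := stub_backgroundScalarTendsto M 𝔄 g ψ W₀ t₀ hψ
    rwa [hW₀] at h
  have hposev : ∀ᶠ t in 𝓝 t₀, ∀ x, 0 < backgroundScalar g (ψ t) x :=
    eventually_forall_pos_of_tendstoUniformly (contMDiff_backgroundScalar g hw₀).continuous hpos₀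
      hunif
  -- the solutions are smooth for `t ≤ 1`; conclude with the dictionary
  have key : ∀ᶠ t in 𝓝 t₀, t ≤ 1 → Solvable g t q := by
    filter_upwards [heq, hposev] with t ht hp htle
    exact solvable_of_background g hg
      (stub_regularity M 𝔄 g hg q hq hqpos hα0 hα1 t htle (ψ t) hp ht) hp ht
  obtain ⟨ε, hε, hball⟩ := exists_Ioo_of_eventually_nhds key
  exact ⟨ε, hε, fun t h1 h2 h3 => hball t h1 h2 h3⟩

/-- **The named fact `gurskyViaclovsky_pathOpen_weighted_four` holds** (alias of `stub_gvOpen` in the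
`X_holds` convention of the tree). [cite: GurskyViaclovsky2003, Prop. 2 and §5] -/
theorem gurskyViaclovsky_pathOpen_weighted_four_holds : gurskyViaclovsky_pathOpen_weighted_four :=
  stub_gvOpen

/-- **THE CRUX `EntropyRung.ChangGurskyYang` (CGY 2003 Thm. A′), PROVED**: the composition
`ChangGurskyYang_of_gvPathFacts` applied to the five analytic facts, each a theorem of the tree.
[cite: ChangGurskyYang2003, Thm. A′ and §2] [cite: GurskyViaclovsky2003, Props. 2, 5, 6 and §5]
[cite: Margerin1998, Thm. 1] [cite: Hamilton1986, §5] -/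
theorem ChangGurskyYang_proof : Summit.SmoothPoincare4.SmoothPoincare4.Theses.EntropyRung.ChangGurskyYang :=
  ChangGurskyYang_of_gvPathFacts gurskyViaclovsky_gradientEstimate_weighted_four_holds
    gurskyViaclovsky_hessianEstimate_weighted_four_holds gurskyViaclovsky_pathOpen_weighted_four_holds
    gurskyViaclovsky_pathClosed_weighted_four_holds hamilton_convergenceCriterion_four_holds

/-- **The same theorem for the item's other route decl `WeylBudget.ChangGurskyYang`** (the two route
decls are the same proposition). [cite: ChangGurskyYang2003, Thm. A′] -/
theorem ChangGurskyYang_weylBudget_proof :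
    Summit.SmoothPoincare4.SmoothPoincare4.Theses.WeylBudget.ChangGurskyYang :=
  ChangGurskyYang_proof

end Summit.SmoothPoincare4.SmoothPoincare4.Theorems.MargerinRails

end
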